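import Summits.Ventures.CertifiedManyBodySolver.Downfold.EmeryFermiScaleLeverCertB
import HarnessLib

/-!
# THE SCALE LEVER AS A THEOREM: the velocity-matched one-band hopping at the node, `t_node(ε) = scaleT(xNode, xNode; ε)`, is strictly DECREASING in the Fermi energy
# whenever `t_pp·Δ < 4t_pd²` — hole doping RAISES the one-band `t` of the σ model's energy-linearised image, for every charge-transfer parameter set in that regime

Venture CertifiedManyBodySolver, cell `pub/hubbard-downfold` (stage S1; INFLATION-RULES-3to1-B §B.69/§B.74 — the SCALE leg of the 3 → 1 reduction: the census `EmeryFermiScalePoints*`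
finds `t_eff(x = 0.16) > t_eff(x = 0)` with disjoint certified windows on 33/33 typed σ rows; this file makes the NODAL part of that sign a theorem of the model), seat
hubbard-downfold-mod-4 (technique B, g29); namespace `Summit.Ventures.CertifiedManyBodySolver.Downfold.Emery`. Sequel of `EmeryFermiScaleNode` (`scaleT_node_eq`:
`t_node = scaleNodeN/scaleNodeD`) and `EmeryFermiScaleLeverCertA/B` (`scaleCert`, `scaleCert_pos`). Everything PROVED (0 sorry). WHAT THIS IS NOT: a statement about any material;
`U = 0` one-body kinematics of the σ model as printed; the nodal point only (the antinodal scale has its own, uncertified, lever); the hypothesis `t_ppΔ < 4t_pd²` is a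
SUFFICIENT regime found by search (seat-side exact-rational sampling: the sign fails for `t_ppΔ ≳ 6t_pd²`; every typed cuprate σ row has `t_ppΔ/t_pd² ∈ [0.55, 1.49]` —
DFT/Wannier-class rows 0.55–1.01, the cLDA / cGW-SIC La₂CuO₄ sets 1.39–1.49 (router/EMERY-FORM-DEFECT.tsv; erratum 2026-08-30 for the g29 print «[0.9, 1.4]») — all far below 4).

* §1 `scaleNode_cross_eq`: `scaleNodeN(ε₁)·scaleNodeD(ε₂) − scaleNodeN(ε₂)·scaleNodeD(ε₁) = (ε₂ − ε₁)·scaleCert(Δ, ε₁, ε₂ − ε₁, t_pd², t_pp′, t_pp − t_pp′, t_pd² − t_pp′ε₂, 4t_pd² − t_ppΔ)`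
  identically (`ring`).
* §2 **`scaleT_node_strictAnti`**: `Δ > 0`, `0 ≤ t_pp′ ≤ t_pp`, `t_pd ≠ 0`, `0 < ε₁ < ε₂`, `t_pp′ε₂ < t_pd²`, `t_ppΔ < 4t_pd²` ⇒ `t_node(ε₂) < t_node(ε₁)`; `…_of_diag` for arbitrary nodal contour
  points (the `fdCheck` convention); the bracket rule `scaleLeverCheck` on rational inputs with soundness `scaleT_node_strictAnti_of_check` (census use: one `decide` per row; `scaleLever_of_brackets` composes it with two ε_F brackets).

Sources: three-band model [HybertsenSchluterChristensen1989, Eq. (1)]; energy-linearised one-band image [AndersenEtAl1995, §6]; Handelman certificates [folklore].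
-/

noncomputable section

namespace Summit.Ventures.CertifiedManyBodySolver.Downfold.Emery

open Real Set

/-! ## §1 The certificate identity -/

/-- **THE CERTIFICATE IDENTITY** (`t_pp = c + h`, `ε₂ = ε₁ + d`): `scaleNodeN(ε₁)·scaleNodeD(ε₁ + d) − scaleNodeN(ε₁ + d)·scaleNodeD(ε₁) = d·scaleCert(…)`. [folklore] -/
theorem scaleNode_cross_eq (Δ tpd c h ε₁ d : ℝ) :
    scaleNodeN Δ tpd (c + h) c ε₁ * scaleNodeD Δ tpd (c + h) c (ε₁ + d) - scaleNodeN Δ tpd (c + h) c (ε₁ + d) * scaleNodeD Δ tpd (c + h) c ε₁ =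
      d * scaleCert Δ ε₁ d (tpd ^ 2) c h (tpd ^ 2 - c * (ε₁ + d)) (4 * tpd ^ 2 - (c + h) * Δ) := by
  unfold scaleNodeN scaleNodeD fsT fsD fsN scaleCert scaleCertP1 scaleCertP2 scaleCertP3 scaleCertP4 scaleCertP5 scaleCertP6 scaleCertP7 scaleCertP8 scaleCertP9
    scaleCertP10 scaleCertP11 scaleCertP12 scaleCertP13 scaleCertP14 scaleCertP15 scaleCertP16 scaleCertP17 scaleCertP18 scaleCertP19 scaleCertP20
  ring

/-! ## §2 The lever -/

/-- **THE NODAL SCALE IS STRICTLY DECREASING IN THE FERMI ENERGY** (`Δ > 0`, `0 ≤ t_pp′ ≤ t_pp`, `t_pd ≠ 0`, `0 < ε₁ < ε₂`, `t_pp′ε₂ < t_pd²`, `t_ppΔ < 4t_pd²`):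
`scaleT(xNode(ε₂), xNode(ε₂); ε₂) < scaleT(xNode(ε₁), xNode(ε₁); ε₁)` — LOWERING the Fermi energy (hole doping) RAISES the velocity-matched one-band `t` at the node. [folklore] -/
theorem scaleT_node_strictAnti {Δ tpd tpp c ε₁ ε₂ : ℝ} (hΔ : 0 < Δ) (hc : 0 ≤ c) (hct : c ≤ tpp) (htpd : tpd ≠ 0) (h1 : 0 < ε₁) (h12 : ε₁ < ε₂)
    (hm : c * ε₂ < tpd ^ 2) (hq : tpp * Δ < 4 * tpd ^ 2) :
    scaleT Δ tpd tpp c (xNode Δ tpd tpp c ε₂) (xNode Δ tpd tpp c ε₂) ε₂ < scaleT Δ tpd tpp c (xNode Δ tpd tpp c ε₁) (xNode Δ tpd tpp c ε₁) ε₁ := by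
  have h2 : 0 < ε₂ := h1.trans h12
  rw [scaleT_node_eq (by linarith) h2.le hc hct htpd, scaleT_node_eq (by linarith) h1.le hc hct htpd,
    div_lt_div_iff₀ (scaleNodeD_pos (by linarith) h2.le hc hct htpd) (scaleNodeD_pos (by linarith) h1.le hc hct htpd), ← sub_pos]
  obtain ⟨h, rfl⟩ : ∃ h, tpp = c + h := ⟨tpp - c, by ring⟩
  obtain ⟨d, rfl⟩ : ∃ d, ε₂ = ε₁ + d := ⟨ε₂ - ε₁, by ring⟩
  have hh : 0 ≤ h := by linarith
  have hd : 0 < d := by linarith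
  have key := scaleNode_cross_eq Δ tpd c h ε₁ d
  rw [key]
  have ha : 0 < tpd ^ 2 := by positivity
  exact mul_pos hd (scaleCert_pos hΔ.le h1 hd ha hc hh (by linarith) (by linarith))

/-- The same for ARBITRARY nodal contour points `(x₁, x₁)` at `ε₁` and `(x₂, x₂)` at `ε₂` (`x₁, x₂ ≥ 0`; they ARE the closed-form nodes, `eq_xNode_of_diag`). [folklore] -/
theorem scaleT_node_strictAnti_of_diag {Δ tpd tpp c ε₁ ε₂ x₁ x₂ : ℝ} (hΔ : 0 < Δ) (hc : 0 ≤ c) (hct : c ≤ tpp) (htpd : tpd ≠ 0) (h1 : 0 < ε₁) (h12 : ε₁ < ε₂)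
    (hm : c * ε₂ < tpd ^ 2) (hq : tpp * Δ < 4 * tpd ^ 2) (hx₁ : 0 ≤ x₁) (hP₁ : charCubic Δ tpd tpp c x₁ x₁ ε₁ = 0) (hx₂ : 0 ≤ x₂)
    (hP₂ : charCubic Δ tpd tpp c x₂ x₂ ε₂ = 0) : scaleT Δ tpd tpp c x₂ x₂ ε₂ < scaleT Δ tpd tpp c x₁ x₁ ε₁ := by
  have h2 : 0 < ε₂ := h1.trans h12
  have hct' : 0 ≤ c + tpp := by linarith
  rw [eq_xNode_of_diag (by linarith) hct' hx₁ (fsN1_pos hct h1.le htpd).ne' hP₁, eq_xNode_of_diag (by linarith) hct' hx₂ (fsN1_pos hct h2.le htpd).ne' hP₂]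
  exact scaleT_node_strictAnti hΔ hc hct htpd h1 h12 hm hq

/-- **`scaleLeverCheck`** — the kernel-decidable bracket rule: a σ point `(Δ, a, b, c) = (Δ_pd, t_pd, t_pp, t_pp′) ∈ ℚ⁴`, the bottom `e₁` of the LOWER ε_F bracket and the top `e₂` of the
HIGHER one; tests: regime, `t_pp′e₂ < t_pd²`, `t_ppΔ < 4t_pd²`. [folklore] -/
def scaleLeverCheck (Δ a b c e₁ e₂ : ℚ) : Bool :=
  decide (0 < Δ) && decide (0 ≤ c) && decide (c ≤ b) && decide (a ≠ 0) && decide (0 < e₁) && decide (c * e₂ < a ^ 2) && decide (b * Δ < 4 * a ^ 2)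

/-- **SOUNDNESS of `scaleLeverCheck`**: for all real `e₁ ≤ ε₁ < ε₂ ≤ e₂`, `t_node(ε₂) < t_node(ε₁)` at the σ point `(Δ, a, b, c)`. [folklore] -/
theorem scaleT_node_strictAnti_of_check {Δ a b c e₁ e₂ : ℚ} (h : scaleLeverCheck Δ a b c e₁ e₂ = true) {ε₁ ε₂ : ℝ} (h1 : (e₁ : ℝ) ≤ ε₁) (h12 : ε₁ < ε₂)
    (h2 : ε₂ ≤ (e₂ : ℝ)) :
    scaleT (Δ : ℝ) a b c (xNode (Δ : ℝ) a b c ε₂) (xNode (Δ : ℝ) a b c ε₂) ε₂ < scaleT (Δ : ℝ) a b c (xNode (Δ : ℝ) a b c ε₁) (xNode (Δ : ℝ) a b c ε₁) ε₁ := by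
  simp only [scaleLeverCheck, Bool.and_eq_true, decide_eq_true_eq] at h
  obtain ⟨⟨⟨⟨⟨⟨hΔ, hc⟩, hcb⟩, ha⟩, he⟩, hm⟩, hq⟩ := h
  have hc' : (0 : ℝ) ≤ c := by exact_mod_cast hc
  have hm' : (c : ℝ) * ε₂ < (a : ℝ) ^ 2 := lt_of_le_of_lt (mul_le_mul_of_nonneg_left h2 hc') (by exact_mod_cast hm)
  exact scaleT_node_strictAnti (by exact_mod_cast hΔ) hc' (by exact_mod_cast hcb) (by exact_mod_cast ha) (lt_of_lt_of_le (by exact_mod_cast he) h1) h12 hm'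
    (by exact_mod_cast hq)

/-- **THE SCALE LEVER FROM BRACKETS**: `scaleLeverCheck Δ a b c e₁ f₂`, `e₂ < f₁`, `ε₁ ∈ [e₁, e₂]`, `ε₂ ∈ [f₁, f₂]` ⇒ `ε₁ < ε₂ ∧ t_node(ε₂) < t_node(ε₁)` (census form: a LOWER ε_F
bracket and a HIGHER one of the same σ row). [folklore] -/
theorem scaleLever_of_brackets {Δ a b c e₁ e₂ f₁ f₂ : ℚ} (h : scaleLeverCheck Δ a b c e₁ f₂ = true) (hgap : e₂ < f₁) {ε₁ ε₂ : ℝ}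
    (h1 : ε₁ ∈ Set.Icc (e₁ : ℝ) e₂) (h2 : ε₂ ∈ Set.Icc (f₁ : ℝ) f₂) :
    ε₁ < ε₂ ∧ scaleT (Δ : ℝ) a b c (xNode (Δ : ℝ) a b c ε₂) (xNode (Δ : ℝ) a b c ε₂) ε₂ < scaleT (Δ : ℝ) a b c (xNode (Δ : ℝ) a b c ε₁) (xNode (Δ : ℝ) a b c ε₁) ε₁ := by
  have hgap' : (e₂ : ℝ) < f₁ := by exact_mod_cast hgap
  have h12 : ε₁ < ε₂ := lt_of_le_of_lt h1.2 (lt_of_lt_of_le hgap' h2.1)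
  exact ⟨h12, scaleT_node_strictAnti_of_check h h1.1 h12 h2.2⟩

end Summit.Ventures.CertifiedManyBodySolver.Downfold.Emery
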